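import Summits.Ventures.PercRepro.RankLevelSetBiIndepSum

/-! # RankLevelSetBiIndepSumPerElem — THE CLASS OF MATROIDS SATISFYING THE PER-ELEMENT PROFILE INEQUALITY (★★) IS
CLOSED UNDER DIRECT SUMS (night-1 g24; dossier §36.9 b)

THEOREM (`biIndepPerElem_disjointSum`): if `M` and `N` satisfy `BiIndepPerElem` (for every element), so does
`M ⊕ N` (`Matroid.disjointSum`). PROOF. For `y ∈ E_M` the marked counts convolve (`RankLevelSetBiIndepSum`):
`Δ_j(M ⊕ N; y) = Σ_{a ≤ j} Δ_a(M; y) · D_{j−a}(N)` with `Δ_a := #{Q ∈ D_{a+1} : y ∈ Q} − #{Z ∈ D_a : y ∉ Z}`.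
By complementation `Δ_a(M) = −Δ_{n₁−1−a}(M)`, so after reflecting the sum (`Finset.sum_range_reflect`)
`2·Δ_j(M ⊕ N) = Σ_{a < n₁} Δ_a(M) · (w_a − w_{n₁−1−a})` with `w_a = D_{j−a}(N)` (`0` for `a > j`); for `2a + 1 < n₁`
the factor `Δ_a(M) ≥ 0` (★★ for `M`) and `w_a ≥ w_{n₁−1−a}` because the profile of `N` is nondecreasing up to the
middle and symmetric (`BiIndepMono N`, from ★★ for `N`) and the two indices `x = j − a ≥ x′ = j − n₁ + 1 + a` have
`x + x′ = 2j − n₁ + 1 < n₂`; for `2a + 1 > n₁` both signs flip; at the middle `Δ_a = 0`. Every term is `≥ 0`.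
`y ∈ E_N` is the same with the summands swapped (`Matroid.disjointSum_comm`). Axioms: standard. -/

namespace PercRepro

open Set Matroid

/-! ## The profile of a matroid with the monotone form dominates towards the middle -/

variable {α : Type}

/-- Under `BiIndepMono N`, `D_i ≤ D_{i+1}` whenever `2i + 1 < #E`. -/
lemma biIndepCount_le_succ_of_mono (N : Matroid α) [N.Finite] (hN : BiIndepMono N) {i : ℕ}
    (hi : 2 * i + 1 < N.E.ncard) : biIndepCount N i ≤ biIndepCount N (i + 1) := by
  have h1 := hN i hi
  have h2 : (i + 1) * biIndepCount N (i + 1) ≤ (N.E.ncard - i) * biIndepCount N (i + 1) :=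
    Nat.mul_le_mul_right _ (by omega)
  have h3 : (N.E.ncard - i) * biIndepCount N i ≤ (N.E.ncard - i) * biIndepCount N (i + 1) := h1.trans h2
  exact Nat.le_of_mul_le_mul_left h3 (by omega)

/-- Under `BiIndepMono N`, `D_{x'} ≤ D_x` for `x' ≤ x ≤ #E / 2`. -/
lemma biIndepCount_mono_of_mono (N : Matroid α) [N.Finite] (hN : BiIndepMono N) {x' x : ℕ} (hxx : x' ≤ x)
    (hx : 2 * x ≤ N.E.ncard) : biIndepCount N x' ≤ biIndepCount N x := by
  induction x, hxx using Nat.le_induction with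
  | base => exact le_rfl
  | succ x hx' ih =>
    exact (ih (by omega)).trans (biIndepCount_le_succ_of_mono N hN (by omega))

/-- **Domination towards the middle**: under `BiIndepMono N`, `D_{x'} ≤ D_x` whenever `x' ≤ x` and `x + x' < #E`
(the smaller index is farther from the middle). -/
lemma biIndepCount_le_of_mono (N : Matroid α) [N.Finite] (hN : BiIndepMono N) {x' x : ℕ} (hxx : x' ≤ x)
    (hsum : x + x' < N.E.ncard) : biIndepCount N x' ≤ biIndepCount N x := by
  by_cases hx : 2 * x ≤ N.E.ncard
  · exact biIndepCount_mono_of_mono N hN hxx hx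
  · rw [← biIndepCount_compl N x (by omega)]
    exact biIndepCount_mono_of_mono N hN (by omega) (by omega)

/-! ## The sequence lemma -/

/-- **The pairing lemma**: for `Δ : ℕ → ℤ` antisymmetric about `(n₁ − 1)/2`, nonnegative below the middle and
vanishing from `n₁` on, and `D : ℕ → ℕ` dominating towards the middle of `n₂`, the convolution
`Σ_{a ≤ j} Δ_a · D_{j−a}` is nonnegative whenever `2j + 1 < n₁ + n₂`. -/
lemma conv_nonneg (Δ : ℕ → ℤ) (D : ℕ → ℕ) (n₁ n₂ j : ℕ)
    (hpos : ∀ a, 2 * a + 1 < n₁ → 0 ≤ Δ a)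
    (hsym : ∀ a, a + 1 ≤ n₁ → Δ a = -Δ (n₁ - 1 - a))
    (hzero : ∀ a, n₁ ≤ a → Δ a = 0)
    (hD : ∀ x' x, x' ≤ x → x + x' < n₂ → D x' ≤ D x)
    (hj : 2 * j + 1 < n₁ + n₂) :
    0 ≤ ∑ a ∈ Finset.range (j + 1), Δ a * (D (j - a) : ℤ) := by
  classical
  -- the weights `w a = D (j − a)` for `a ≤ j`, `0` beyond
  set w : ℕ → ℤ := fun a => if a ≤ j then (D (j - a) : ℤ) else 0 with hw
  have hw0 : ∀ a, 0 ≤ w a := by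
    intro a; simp only [hw]; split_ifs <;> positivity
  -- both sums equal the sum over `range (n₁ + j + 1)`
  have hS : ∑ a ∈ Finset.range (j + 1), Δ a * (D (j - a) : ℤ) = ∑ a ∈ Finset.range (n₁ + j + 1), Δ a * w a := by
    have h1 : ∑ a ∈ Finset.range (j + 1), Δ a * (D (j - a) : ℤ) = ∑ a ∈ Finset.range (j + 1), Δ a * w a := by
      refine Finset.sum_congr rfl (fun a ha => ?_)
      rw [Finset.mem_range] at ha
      have : w a = (D (j - a) : ℤ) := by simp only [hw]; rw [if_pos (by omega)]
      rw [this]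
    rw [h1]
    refine Finset.sum_subset (Finset.range_mono (by omega : j + 1 ≤ n₁ + j + 1)) ?_
    intro a _ ha
    rw [Finset.mem_range] at ha
    have : w a = 0 := by simp only [hw]; rw [if_neg (by omega)]
    rw [this, mul_zero]
  have hS' : ∑ a ∈ Finset.range n₁, Δ a * w a = ∑ a ∈ Finset.range (n₁ + j + 1), Δ a * w a := by
    refine Finset.sum_subset (Finset.range_mono (by omega : n₁ ≤ n₁ + j + 1)) ?_
    intro a _ ha
    rw [Finset.mem_range] at ha
    rw [hzero a (by omega), zero_mul]
  rw [hS, ← hS']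
  -- reflect
  have hrefl : ∑ a ∈ Finset.range n₁, Δ a * w a = ∑ a ∈ Finset.range n₁, -(Δ a * w (n₁ - 1 - a)) := by
    conv_lhs => rw [← Finset.sum_range_reflect (fun a => Δ a * w a) n₁]
    refine Finset.sum_congr rfl (fun a ha => ?_)
    rw [Finset.mem_range] at ha
    rw [hsym (n₁ - 1 - a) (by omega), show n₁ - 1 - (n₁ - 1 - a) = a by omega, neg_mul]
  have h2 : 2 * ∑ a ∈ Finset.range n₁, Δ a * w a =
      ∑ a ∈ Finset.range n₁, Δ a * (w a - w (n₁ - 1 - a)) := by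
    rw [two_mul]
    nth_rewrite 2 [hrefl]
    rw [← Finset.sum_add_distrib]
    refine Finset.sum_congr rfl (fun a _ => ?_)
    ring
  have hterm : ∀ a ∈ Finset.range n₁, 0 ≤ Δ a * (w a - w (n₁ - 1 - a)) := by
    intro a ha
    rw [Finset.mem_range] at ha
    -- the comparison of the weights
    have hcmp : ∀ b c, b ≤ c → b + c = n₁ - 1 → w c ≤ w b := by
      intro b c hbc hbcn
      simp only [hw]
      split_ifs with hc hb hb
      · -- both ≤ j
        have := hD (j - c) (j - b) (by omega) (by omega)
        exact_mod_cast this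
      · exact absurd (hbc.trans hc) hb
      · positivity
      · exact le_rfl
    rcases lt_trichotomy (2 * a + 1) n₁ with hlt | heq | hgt
    · have hΔ := hpos a hlt
      have hwa := hcmp a (n₁ - 1 - a) (by omega) (by omega)
      exact mul_nonneg hΔ (by linarith)
    · have hΔ : Δ a = 0 := by
        have := hsym a (by omega)
        rw [show n₁ - 1 - a = a by omega] at this
        linarith
      rw [hΔ, zero_mul]
    · have hΔ : Δ a ≤ 0 := by
        have := hsym a (by omega)
        have := hpos (n₁ - 1 - a) (by omega)
        linarith
      have hwa := hcmp (n₁ - 1 - a) a (by omega) (by omega)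
      exact mul_nonneg_of_nonpos_of_nonpos hΔ (by linarith)
  have hsum : 0 ≤ ∑ a ∈ Finset.range n₁, Δ a * (w a - w (n₁ - 1 - a)) := Finset.sum_nonneg hterm
  linarith

/-! ## The closure theorem -/

variable {M N : Matroid α} [M.Finite] [N.Finite] {h : Disjoint M.E N.E}

/-- **(★★) at an element of the first summand**: if `M` satisfies (★★) at `y ∈ E_M` (for all `j`) and `N` has the
monotone profile, then `M ⊕ N` satisfies (★★) at `y`. -/
theorem biIndepPerElem_disjointSum_left (hM : BiIndepPerElem M) (hN : BiIndepMono N) {y : α} (hy : y ∈ M.E)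
    {j : ℕ} (hj : 2 * j + 1 < (M.disjointSum N h).E.ncard) :
    {Z ∈ biIndep (M.disjointSum N h) j | y ∉ Z}.ncard ≤ {Q ∈ biIndep (M.disjointSum N h) (j + 1) | y ∈ Q}.ncard := by
  classical
  have hn : (M.disjointSum N h).E.ncard = M.E.ncard + N.E.ncard := by
    rw [Matroid.disjointSum_ground_eq, Set.ncard_union_eq h M.ground_finite N.ground_finite]
  rw [hn] at hj
  rw [ncard_mem_biIndep_disjointSum (h := h) hy j, ncard_not_mem_biIndep_disjointSum (h := h) hy j]
  set Δ : ℕ → ℤ := fun a =>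
    ({Q₁ ∈ biIndep M (a + 1) | y ∈ Q₁}.ncard : ℤ) - ({Z₁ ∈ biIndep M a | y ∉ Z₁}.ncard : ℤ) with hΔ
  have key := conv_nonneg Δ (fun x => biIndepCount N x) M.E.ncard N.E.ncard j ?_ ?_ ?_ ?_ hj
  · have : (∑ a ∈ Finset.range (j + 1), ({Z₁ ∈ biIndep M a | y ∉ Z₁}.ncard * (biIndep N (j - a)).ncard : ℕ) : ℤ) ≤
        (∑ a ∈ Finset.range (j + 1), ({Q₁ ∈ biIndep M (a + 1) | y ∈ Q₁}.ncard * (biIndep N (j - a)).ncard : ℕ) : ℤ) := by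
      push_cast
      have e : ∑ a ∈ Finset.range (j + 1), Δ a * ((biIndepCount N (j - a) : ℕ) : ℤ) =
          ∑ a ∈ Finset.range (j + 1), (({Q₁ ∈ biIndep M (a + 1) | y ∈ Q₁}.ncard : ℤ) * ((biIndep N (j - a)).ncard : ℤ)) -
          ∑ a ∈ Finset.range (j + 1), (({Z₁ ∈ biIndep M a | y ∉ Z₁}.ncard : ℤ) * ((biIndep N (j - a)).ncard : ℤ)) := by
        rw [← Finset.sum_sub_distrib]
        refine Finset.sum_congr rfl (fun a _ => ?_)
        simp only [hΔ, biIndepCount]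
        ring
      rw [e] at key
      linarith
    exact_mod_cast this
  · intro a ha
    simp only [hΔ]
    have := hM y hy a ha
    have h' : (({Z₁ ∈ biIndep M a | y ∉ Z₁}.ncard : ℕ) : ℤ) ≤ (({Q₁ ∈ biIndep M (a + 1) | y ∈ Q₁}.ncard : ℕ) : ℤ) :=
      by exact_mod_cast this
    linarith
  · intro a ha
    simp only [hΔ]
    rw [ncard_mem_biIndep_eq_not_mem_compl M hy ha]
    have e : M.E.ncard - 1 - (M.E.ncard - 1 - a) = a := by omega
    by_cases ha' : M.E.ncard - 1 - a + 1 ≤ M.E.ncard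
    · rw [ncard_mem_biIndep_eq_not_mem_compl M hy ha', e]
      ring
    · -- only when `#E = 0`, impossible as `y ∈ E`
      exfalso
      have hpos : 0 < M.E.ncard := (Set.ncard_pos M.ground_finite).mpr ⟨y, hy⟩
      omega
  · intro a ha
    simp only [hΔ]
    rw [ncard_not_mem_biIndep_eq_zero M hy ha]
    have e : {Q₁ ∈ biIndep M (a + 1) | y ∈ Q₁} = ∅ := by
      rw [biIndep_eq_empty_of_lt M (by omega : M.E.ncard < a + 1)]
      ext Q; simp
    rw [e, Set.ncard_empty]
    simp
  · intro x' x hxx hsum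
    exact biIndepCount_le_of_mono N hN hxx hsum

/-- **THE CLASS OF (★★)-MATROIDS IS CLOSED UNDER DIRECT SUMS**: `BiIndepPerElem M → BiIndepPerElem N →
BiIndepPerElem (M ⊕ N)`. -/
theorem biIndepPerElem_disjointSum (hM : BiIndepPerElem M) (hN : BiIndepPerElem N) :
    BiIndepPerElem (M.disjointSum N h) := by
  intro y hy j hj
  rw [Matroid.disjointSum_ground_eq] at hy
  rcases hy with hyM | hyN
  · exact biIndepPerElem_disjointSum_left hM (biIndepMono_of_perElem N hN) hyM hj
  · have e : M.disjointSum N h = N.disjointSum M h.symm := Matroid.disjointSum_comm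
    rw [e] at hj ⊢
    exact biIndepPerElem_disjointSum_left hN (biIndepMono_of_perElem M hM) hyN hj

end PercRepro
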